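import Summits.AtomisticToContinuum.Crystallization.Theorems.FrustratedLawDichotomyStrainedPatchHomEntryLeafHTA2QCellBMA1

/-!
# K1-v2 IN THE KERNEL at the mixed bulk cell `cB065 × wBMA`, part 2: ★★★ the certificate side `htCertSideA2Q pBMA2 QBM GnBM JB065 cB065 wBMA = true`
# (27623 `(H) HomFloor (1/625)`, hcp half; hand-1 g35; critic row 1331 (2c))

decomp-a2c hand-1 g35.  KERNEL (seat probes N1/N3): `restBMA2` (`htCertRestA2`: ball / jac / straddlers / PSD confinement / curvature floor `λ₁ = 0.705` / far Jacobians /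
guards), `linBMA2` (`1002485858750 ≤ 1003500000000`), `farBMA2` (`1052841557969 ≤ 1059200000000`); with `…CellBMA1.qBM_0/1/2`: ★★★ `htCertSideA2Q_BMA2`.

Kernel facts + assembly; 0 sorry; standard axioms; no definitions.  `--supports stmt-AtomisticToContinuum-27623`.
-/

namespace Summit.AtomisticToContinuum.Crystallization.Theorems.FrustratedLawDichotomyStrainedPatchHomEntryLeafHT

open Literature.Analysis.ValidatedNumerics.Numerics
open Summit.AtomisticToContinuum.Crystallization.Theorems.FrustratedLawDichotomyStrainedPatchHomCertTree (CertTree treeOK)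
open Summit.AtomisticToContinuum.Crystallization.Theorems.FrustratedLawDichotomyStrainedPatchHomEntryTable (muRec)
open Summit.AtomisticToContinuum.Crystallization.Theorems.FrustratedLawDichotomyStrainedPatchHomEntryFitHcpCentred (entryLeafOKHQDCR)
open Summit.AtomisticToContinuum.Crystallization.Theorems.FrustratedLawDichotomyStrainedPatchHomSlopeLJ
open Summit.AtomisticToContinuum.Crystallization.Theorems.FrustratedLawDichotomyStrainedPatchHomSlopeLJAffine
open Summit.AtomisticToContinuum.Crystallization.Theorems.FrustratedLawDichotomyStrainedPatchHomSlopeLJAffine2Kit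

set_option maxRecDepth 100000 in
set_option maxHeartbeats 4000000 in
/-- ★ KERNEL: the non-slope conjuncts of the certificate side of the mixed cell. -/
theorem restBMA2 : htCertRestA2 pBMA2 JB065 cB065 wBMA = true := by
  decide +kernel

set_option maxRecDepth 100000 in
set_option maxHeartbeats 4000000 in
/-- ★ KERNEL: `g₀ + lin + ⌈√ΣQ²⌉ + rem3 + nai = 1002485858750 ≤ GnBM`. -/
theorem linBMA2 : g0LJ cB065 (htScA2F cB065 wBMA JB065 (htNearU cB065 wBMA)) + linLJA cB065 wBMA JB065 (htScA2F cB065 wBMA JB065 (htNearU cB065 wBMA)) + sqrtQ QBM +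
    rem3LJ cB065 (hullW JB065 wBMA) (htScA2F cB065 wBMA JB065 (htNearU cB065 wBMA)) + naiSLJ cB065 (hullW JB065 wBMA) (htSnA2F cB065 wBMA JB065 (htNearU cB065 wBMA)) ≤ GnBM := by
  decide +kernel

set_option maxRecDepth 100000 in
set_option maxHeartbeats 4000000 in
/-- KERNEL: `GnBM + far₁ + far₂ = 1052841557969 ≤ Gs`. -/
theorem farBMA2 : GnBM + htGsNA cB065 wBMA JB065 (htFar1U cB065 wBMA) + htGsNA cB065 wBMA JB065 (htFar2U cB065 wBMA) ≤ pBMA2.Gs := by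
  decide +kernel

/-- ★★★ **THE SECOND-ORDER AFFINE CERTIFICATE SIDE OF THE MIXED BULK CELL HOLDS** (six kernel facts; slack `0.60 %` of `Gs`). [assembly] -/
theorem htCertSideA2Q_BMA2 : htCertSideA2Q pBMA2 QBM GnBM JB065 cB065 wBMA = true :=
  htCertSideA2Q_of_parts restBMA2 qBM_0 qBM_1 qBM_2 linBMA2 farBMA2

end Summit.AtomisticToContinuum.Crystallization.Theorems.FrustratedLawDichotomyStrainedPatchHomEntryLeafHT
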